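/-
Origin: expansion seat `prover-pub-hodgecm-mc-discharge-3-g7-0`, handover #6 16:49Z md5 29b8cf2a44be (353 l.; NEW additive KERNEL leaf, ns HodgeCM.Model.HypCensus; imports row #5 `HodgeCM.Model.HypCensus.ArchDatumPlacesCMSigns` + twins `HodgeCM.Vendored.H21.NumberTheory.Weil1964.ArchWeilDatumReindex`, `…Weil1964.ArchPlacePhaseHomBlock`, `…RepresentationTheory.KonnoKonno2007.RealUnitaryDualPairRelabel`, `…Weil1964.ArchFollandDualPairPlaceSectionFrame`; 1 data def `cmPlace ι₁` (the real place under ι₁) + 12 reducible abbrevs naming the canonical frame data / composites (`cmXV cmCW cmXW cmEpsV cmEpsW cmDV cmDW cmArchPairPhaseHom cmBigFrame cmBlockSplit cmBlockRelabel cmBlockPhaseHom cmBlockRep cmBlockSection`) + 11 theorems: `cmDV_ne_zero cmDW_ne_zero cmCW_ne_zero cm_htV cm_htW`, **`isArchWeilDatum_cmBlock (h₁V h₁W hV hW) : IsArchWeilDatum (cmBlockPhaseHom … eP eQ) (cmBlockRep … eP eQ)`** (= BRICK-4 `hW`; rows #5 `_of_signs` + T1 `IsArchWeilDatum.reindex`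 ×2), `isArchWeilDatum_cmBlock_two (h₁V h₁W hV)` (M = 2), **`continuous_cmBlockRep`** (= `hc`), **`continuous_cmBlockSection`** (= `hs_cont`), **`coe_cmBlockPhaseHom_cmBlockSection : ⇑(cmBlockPhaseHom … (cmBlockSection … u)).1 = blockPhase ⇑(ι𝕎 (Fin 2) Unit (PosIdx (cmXW … v₁)) (NegIdx (cmXW … v₁)) u).1 id`** (= `hs`; T2 `coe_reindexSp_piPhaseHom_comp_section` + T4 `archPairPlace_archPairSection` + T3 `coe_reindexSp_sumCongr_of_eq_blockPhase`), where `cmBlockPhaseHom eP eQ : arch J_V × arch J_W →* Sp(ℝ^{DPIdx (Fin 2) Unit (PosIdx x_W(v₁)) (NegIdx x_W(v₁)) ⊕ (Fin n × {v ≠ v₁})})`, `cmBlockRep eP eQ := repTransport (reindexCLE relabel) (repTransport (reindexCLE split) (repTransport (scaled Folland frame) cmArchWeilRep))`, `cmBlockSection eP eQ := archPairSection (canonical frames, v₁) ∘ (Ginf.relabel eP eQ refl refl)⁻¹ : Ginf (Fin 2) Unit (PosIdx x_W(v₁)) (NegIdx x_W(v₁)) →* arch J_V × arch J_W`, inputs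 `eP : PosIdx (cmXV … v₁) ≃ Fin 2`, `eQ : NegIdx (cmXV … v₁) ≃ Unit` (from the (2,1) sign fact at ι₁). 0 Prop defs, 0 records, nothing cited, MODEL-N ±0, E unchanged; binder-2's `ArchFactor`/`ArchDatum`/`ArchDatumCM` and rows #1–#5 untouched. EVIDENCE: hub-farm `lean check` rc 0 / 0 sorries / 0 warnings, 94 s, ≈16:48Z, of the concatenation `mc/pub-hodgecm-mc-discharge-3/notes/check_block_concat.lean` 5b3f19b4f5b6 (3552 l.; log `notes/check_block_concat.log`); `#print axioms coe_cmBlockPhaseHom_cmBlockSection` / `isArchWeilDatum_cmBlock_two` = trio.) (`HOME/mc/pub-hodgecm-mc-discharge-3/stage/HodgeCM/Model/HypCensus/ArchDatumBlockCM.lean`, md5 29b8cf2a, 353 lines);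
landed by the gen-12 packager (p-g12) in gate run 36 as `HodgeCM/Model/HypCensus/ArchDatumBlockCM.lean` (verbatim).
-/
/-
Origin: speedrun cell pub-hodgecm, MODEL-CONSTRUCTION sub-cell, discharge seat mc-discharge-3 (unit pub-hodgecm-mc-discharge-3,
seat prover-pub-hodgecm-mc-discharge-3-g7-0, gen 7), ticket D-3 follow-on row #6 (offer 16:20Z): the (J-arch) datum of the CM pin IN THE
BLOCK FRAME of `Model/ArchKTypeJunction` § 2 — ASSEMBLY ONLY of rows #4/#5 with the tree leaves T1 `Weil1964/ArchWeilDatumReindex`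
(p190438), T2 `Weil1964/ArchPlacePhaseHomBlock` (p190469), T3 `KonnoKonno2007/RealUnitaryDualPairRelabel` (p190683), T4
`Weil1964/ArchFollandDualPairPlaceSection(Frame)` (p190890 / p190993).  Target in PKG: `HodgeCM/Model/HypCensus/ArchDatumBlockCM.lean`
(NEW additive leaf; imports row #5 + the four K-1 twins).  KERNEL only: 0 records / named facts / proof holes; the definitions are
abbreviations of composites of landed terms.
-/
import Summits.HodgeConjecture.HodgeCM.Model.HypCensus.ArchDatumPlacesCMSigns
import Literature.NumberTheory.Weil1964.ArchWeilDatumReindex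
import Literature.NumberTheory.Weil1964.ArchPlacePhaseHomBlock
import Literature.RepresentationTheory.KonnoKonno2007.RealUnitaryDualPairRelabel
import Literature.NumberTheory.Weil1964.ArchFollandDualPairPlaceSectionFrame

/-!
# Census kit (rows A12/A34), junction (J-arch)→(J-plc): the archimedean Weil datum of the CM pin in the BLOCK FRAME of one place

`ArchDatumPlacesCMSigns` (row #5) gives `IsArchWeilDatum (archPairPhaseHom … <canonical frames>) (repTransport <scaled Folland frame>
(cmArchWeilRep …))` from sign facts, in weil-2's place frame `Fin n × {v real}`.  The consumer `Model/ArchKTypeJunction` § 2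
(`ArchKTypeData.isWeaklyPDiff_of_blockPair` / `isPMinusKilledAlong_of_blockPair`) is typed on a BLOCK frame
`DPIdx (Fin 2) Unit R S ⊕ σ₂` and asks for five inputs `hW hc s hs_cont hs`.  This leaf assembles them at the pin, for the real
place `v₁ = cmPlace ι₁` under the distinguished embedding `ι₁`, the canonical sign frames (`cmSignConv`), and two frame bijections
`eP : PosIdx (x_V v₁) ≃ Fin 2`, `eQ : NegIdx (x_V v₁) ≃ Unit` (signature `(2,1)` at `ι₁`; `R := PosIdx (x_W v₁)`, `S := NegIdx (x_W v₁)`):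

* §1 the canonical frame data of the pin as abbreviations (`cmXV`, `cmXW`, `cmEpsV`, `cmEpsW`, `cmDV`, `cmDW`, `cmCW`) and their
  side conditions (`cmDV_ne_zero`, …, `cm_htV`, `cm_htW`), the place `cmPlace ι₁`, the phase homomorphism `cmArchPairPhaseHom`,
  the frame `cmBigFrame`, the split `cmBlockSplit`, the relabelling `cmBlockRelabel`;
* §2 **`cmBlockPhaseHom eP eQ : arch J_V × arch J_W →* Sp(ℝ^{DPIdx (Fin 2) Unit R S ⊕ (Fin n × {v ≠ v₁})})`** and
  **`cmBlockRep eP eQ : Representation ℂ (arch J_V × arch J_W) 𝓢(ℝ^{…})`** with **`isArchWeilDatum_cmBlock`** (= `hW`; rows #4/#5 +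
  `IsArchWeilDatum.reindex` twice) and **`continuous_cmBlockRep`** (= `hc`);
* §3 **`cmBlockSection eP eQ : Ginf (Fin 2) Unit R S →* arch J_V × arch J_W`** (= `s`; T4 `archPairSection` ∘ T3 `Ginf.relabel⁻¹`),
  **`continuous_cmBlockSection`** (= `hs_cont`) and **`coe_cmBlockPhaseHom_cmBlockSection`** (= `hs`:
  `⇑(cmBlockPhaseHom eP eQ (cmBlockSection eP eQ u)) = blockPhase ⇑(ι𝕎 (Fin 2) Unit R S u) id`; T2 + T3 + T4).

With these, BRICK-4 § 2 at the pin needs only theta-3's chart/intertwiner data `e τ hτ Φ₁ Φ₂ hΦ` and theta-1's small datum `hW₁ hvac₁`.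
Nothing here is a claim of PerL/QW8.  [Folland1989, Prop. (1.43), §4.2; Weil1964, Chap. I n° 12, Chap. III n° 37–39] is the provenance.
Style lint (L-notation): no `local notation`.
-/

set_option autoImplicit false

noncomputable section

open NumberField NumberField.InfinitePlace IsDedekindDomain MeasureTheory
open scoped Matrix
open scoped Kronecker Classical TensorProduct ComplexConjugate
open Literature.NumberTheory.Automorphic Literature.NumberTheory.Automorphic.UnitaryGroup Literature.NumberTheory.Weil1964
open Literature.RepresentationTheory.HeisenbergGroup (polar Heisenberg symplecticGroup ofSymplectic)
open Literature.RepresentationTheory.KonnoKonno2007 Literature.RepresentationTheory.KonnoKonno2007.RealDualPair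
open Literature.NumberTheory.GelbartRogawski1991 Literature.NumberTheory.GelbartRogawski1991.UnitaryDualPair
open Literature.Analysis.SegalBargmann

namespace HodgeCM.Model.HypCensus

section CMPinBlock

variable (L : Type) [Field L] [NumberField L] [IsCMField L] {N M n : ℕ} (e : Fin N × Fin M ≃ Fin n)
variable (dV : Fin N → L) (hdV : ∀ i, IsCMField.complexConj L (dV i) = dV i) (hdV0 : ∀ i, dV i ≠ 0)
variable (dW : Fin M → L) (hdW : ∀ i, IsCMField.complexConj L (dW i) = dW i) (hdW0 : ∀ i, dW i ≠ 0)
variable (hGR : (cmSplittingDatum L e dV hdV hdV0 dW hdW hdW0).CompatibleSplitting) (ι₁ : L →+* ℂ)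

/-! ## §1 The canonical frame data of the pin -/

/-- the real place of `L⁺` under the embedding `ι₁`. -/
def cmPlace : {v : InfinitePlace ↥(maximalRealSubfield L) // v.IsReal} :=
  ⟨(InfinitePlace.mk ι₁).comap (algebraMap (↥(maximalRealSubfield L)) L), IsTotallyReal.isReal _⟩

/-- the `V`-side sign vector at a real place in the canonical convention `cmSignConv`. -/
abbrev cmXV (v : {v : InfinitePlace ↥(maximalRealSubfield L) // v.IsReal}) : Fin N → ℝ :=
  placeSignVec (cmRealVec L dV hdV) (cmSignConv L dV ι₁) v

/-- the `W`-side scalar `c_W v = im σ_{w(v)}(δ_L) / c_V v`. -/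
abbrev cmCW (v : {v : InfinitePlace ↥(maximalRealSubfield L) // v.IsReal}) : ℝ :=
  ((cmPlaceOver L v).1.embedding (imagUnit L)).im / cmSignConv L dV ι₁ v

/-- the `W`-side sign vector at a real place. -/
abbrev cmXW (v : {v : InfinitePlace ↥(maximalRealSubfield L) // v.IsReal}) : Fin M → ℝ :=
  placeSignVec (cmRealVec L dW hdW) (cmCW L dV ι₁) v

/-- canonical `V`-frame `signSplit`. -/
abbrev cmEpsV (v : {v : InfinitePlace ↥(maximalRealSubfield L) // v.IsReal}) :
    Fin N ≃ PosIdx (cmXV L dV hdV ι₁ v) ⊕ NegIdx (cmXV L dV hdV ι₁ v) :=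
  signSplit (cmXV L dV hdV ι₁ v)

/-- canonical `W`-frame `signSplit`. -/
abbrev cmEpsW (v : {v : InfinitePlace ↥(maximalRealSubfield L) // v.IsReal}) :
    Fin M ≃ PosIdx (cmXW L dV dW hdW ι₁ v) ⊕ NegIdx (cmXW L dV dW hdW ι₁ v) :=
  signSplit (cmXW L dV dW hdW ι₁ v)

/-- canonical `V`-scaling `√|x_V|`. -/
abbrev cmDV (v : {v : InfinitePlace ↥(maximalRealSubfield L) // v.IsReal}) : Fin N → ℝ := sqrtAbs (cmXV L dV hdV ι₁ v)

/-- canonical `W`-scaling `√|x_W|`. -/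
abbrev cmDW (v : {v : InfinitePlace ↥(maximalRealSubfield L) // v.IsReal}) : Fin M → ℝ := sqrtAbs (cmXW L dV dW hdW ι₁ v)

include hdV0 in
/-- `√|x_V| ≠ 0`. -/
theorem cmDV_ne_zero : ∀ v i, cmDV L dV hdV ι₁ v i ≠ 0 := fun v i =>
  sqrtAbs_ne_zero (div_ne_zero ((map_ne_zero _).2 (ne_zero_of_isUnit_det_diagonal (isUnit_det_realDiagonal L dV hdV hdV0) i))
    (cmSignConv_ne_zero L dV ι₁ v))

include hdW0 in
/-- `√|x_W| ≠ 0`. -/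
theorem cmDW_ne_zero : ∀ v j, cmDW L dV dW hdW ι₁ v j ≠ 0 := fun v j =>
  sqrtAbs_ne_zero (div_ne_zero ((map_ne_zero _).2 (ne_zero_of_isUnit_det_diagonal (isUnit_det_realDiagonal L dW hdW hdW0) j))
    (div_ne_zero (im_embedding_cmPlaceOver_imagUnit_ne_zero L v) (cmSignConv_ne_zero L dV ι₁ v)))

/-- `c_W v ≠ 0`. -/
theorem cmCW_ne_zero : ∀ v, cmCW L dV ι₁ v ≠ 0 := fun v =>
  div_ne_zero (im_embedding_cmPlaceOver_imagUnit_ne_zero L v) (cmSignConv_ne_zero L dV ι₁ v)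

include hdV0 in
/-- the `V`-side Sylvester identity `σ_v(d_V i) = c_V · sign · D²`. -/
theorem cm_htV : ∀ v i, embedding_of_isReal v.2 (cmRealVec L dV hdV i) =
    cmSignConv L dV ι₁ v * signOf (cmEpsV L dV hdV ι₁ v i) * cmDV L dV hdV ι₁ v i ^ 2 := fun v i =>
  eq_mul_signOf_signSplit_mul_sqrtAbs_sq (cmSignConv_ne_zero L dV ι₁ v) (fun j => embedding_of_isReal v.2 (cmRealVec L dV hdV j)) i
    ((map_ne_zero _).2 (ne_zero_of_isUnit_det_diagonal (isUnit_det_realDiagonal L dV hdV hdV0) i))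

include hdW0 in
/-- the `W`-side Sylvester identity. -/
theorem cm_htW : ∀ v j, embedding_of_isReal v.2 (cmRealVec L dW hdW j) =
    cmCW L dV ι₁ v * signOf (cmEpsW L dV dW hdW ι₁ v j) * cmDW L dV dW hdW ι₁ v j ^ 2 := fun v j =>
  eq_mul_signOf_signSplit_mul_sqrtAbs_sq (cmCW_ne_zero L dV ι₁ v) (fun j => embedding_of_isReal v.2 (cmRealVec L dW hdW j)) j
    ((map_ne_zero _).2 (ne_zero_of_isUnit_det_diagonal (isUnit_det_realDiagonal L dW hdW hdW0) j))

/-- **the (J-arch) phase homomorphism of the pin in canonical frames** (row #5's `archPairPhaseHom …` with its arguments named). -/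
abbrev cmArchPairPhaseHom :
    UnitaryGroup.arch (↥(maximalRealSubfield L)) L (IsCMField.complexConj L) N (Matrix.diagonal dV) ×
        UnitaryGroup.arch (↥(maximalRealSubfield L)) L (IsCMField.complexConj L) M (Matrix.diagonal dW) →*
      symplecticGroup (polar (dotPairing (Fin n × {v : InfinitePlace ↥(maximalRealSubfield L) // v.IsReal}))) :=
  archPairPhaseHom L (IsCMField.complexConj L) N M e (IsCMField.complexConj_ne_one L) (cmPlaceOver L)
    (cmPlaceOver_smul L) (cmPlaceOver_comap L) (cmRealVec L dV hdV) (cmRealVec L dW hdW)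
    (realDiagonal_map L dV hdV).symm (realDiagonal_map L dW hdW).symm (cmEpsV L dV hdV ι₁) (cmEpsW L dV dW hdW ι₁)
    (cmDV_ne_zero L dV hdV hdV0 ι₁) (cmDW_ne_zero L dV dW hdW hdW0 ι₁) (cmSignConv_ne_zero L dV ι₁) (cmCW_ne_zero L dV ι₁)
    (cm_htV L dV hdV hdV0 ι₁) (cm_htW L dV dW hdW hdW0 ι₁)

/-- **the scaled Folland frame of the pin** in the canonical scalings. -/
abbrev cmBigFrame :
    (Fin n → mixedEmbedding.mixedSpace ↥(maximalRealSubfield L)) ≃L[ℝ]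
      (Fin n × {v : InfinitePlace ↥(maximalRealSubfield L) // v.IsReal} → ℝ) :=
  scaledFrame (↥(maximalRealSubfield L)) (Fin n) (pairScale N M (e := e) (cmDV L dV hdV ι₁) (cmDW L dV dW hdW ι₁))
    (pairScale_ne_zero N M (cmDV_ne_zero L dV hdV hdV0 ι₁) (cmDW_ne_zero L dV dW hdW hdW0 ι₁))

/-- the split of the place frame at `v₁ = cmPlace ι₁`, the slice read in Konno–Konno's block index. -/
abbrev cmBlockSplit :
    DPIdx (PosIdx (cmXV L dV hdV ι₁ (cmPlace L ι₁))) (NegIdx (cmXV L dV hdV ι₁ (cmPlace L ι₁)))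
        (PosIdx (cmXW L dV dW hdW ι₁ (cmPlace L ι₁))) (NegIdx (cmXW L dV dW hdW ι₁ (cmPlace L ι₁))) ⊕
        (Fin n × {v : {v : InfinitePlace ↥(maximalRealSubfield L) // v.IsReal} // v ≠ cmPlace L ι₁}) ≃
      Fin n × {v : InfinitePlace ↥(maximalRealSubfield L) // v.IsReal} :=
  placeSplitEquiv
    (pairFrame (PosIdx (cmXV L dV hdV ι₁ (cmPlace L ι₁))) (NegIdx (cmXV L dV hdV ι₁ (cmPlace L ι₁)))
      (PosIdx (cmXW L dV dW hdW ι₁ (cmPlace L ι₁))) (NegIdx (cmXW L dV dW hdW ι₁ (cmPlace L ι₁))) e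
      (cmEpsV L dV hdV ι₁ (cmPlace L ι₁)) (cmEpsW L dV dW hdW ι₁ (cmPlace L ι₁)))
    (cmPlace L ι₁)

variable (eP : PosIdx (cmXV L dV hdV ι₁ (cmPlace L ι₁)) ≃ Fin 2) (eQ : NegIdx (cmXV L dV hdV ι₁ (cmPlace L ι₁)) ≃ Unit)

/-- the relabelling of the `V`-side block types to the literal `Fin 2`, `Unit` of the ball frame. -/
abbrev cmBlockRelabel :
    (DPIdx (Fin 2) Unit (PosIdx (cmXW L dV dW hdW ι₁ (cmPlace L ι₁))) (NegIdx (cmXW L dV dW hdW ι₁ (cmPlace L ι₁))) ⊕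
        (Fin n × {v : {v : InfinitePlace ↥(maximalRealSubfield L) // v.IsReal} // v ≠ cmPlace L ι₁})) ≃
      (DPIdx (PosIdx (cmXV L dV hdV ι₁ (cmPlace L ι₁))) (NegIdx (cmXV L dV hdV ι₁ (cmPlace L ι₁)))
          (PosIdx (cmXW L dV dW hdW ι₁ (cmPlace L ι₁))) (NegIdx (cmXW L dV dW hdW ι₁ (cmPlace L ι₁))) ⊕
        (Fin n × {v : {v : InfinitePlace ↥(maximalRealSubfield L) // v.IsReal} // v ≠ cmPlace L ι₁})) :=
  Equiv.sumCongr
    (dpIdxCongr (PosIdx (cmXV L dV hdV ι₁ (cmPlace L ι₁))) (NegIdx (cmXV L dV hdV ι₁ (cmPlace L ι₁)))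
      (PosIdx (cmXW L dV dW hdW ι₁ (cmPlace L ι₁))) (NegIdx (cmXW L dV dW hdW ι₁ (cmPlace L ι₁))) (Fin 2) Unit
      (PosIdx (cmXW L dV dW hdW ι₁ (cmPlace L ι₁))) (NegIdx (cmXW L dV dW hdW ι₁ (cmPlace L ι₁))) eP eQ (Equiv.refl _)
      (Equiv.refl _)).symm
    (Equiv.refl _)

/-! ## §2 The big datum of the pin in the block frame: `hW` and `hc` -/

/-- **`ι𝕎′`**: the (J-arch) phase homomorphism read in the block frame of the place under `ι₁`. -/
abbrev cmBlockPhaseHom :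
    UnitaryGroup.arch (↥(maximalRealSubfield L)) L (IsCMField.complexConj L) N (Matrix.diagonal dV) ×
        UnitaryGroup.arch (↥(maximalRealSubfield L)) L (IsCMField.complexConj L) M (Matrix.diagonal dW) →*
      symplecticGroup (polar (dotPairing
        (DPIdx (Fin 2) Unit (PosIdx (cmXW L dV dW hdW ι₁ (cmPlace L ι₁))) (NegIdx (cmXW L dV dW hdW ι₁ (cmPlace L ι₁))) ⊕
          (Fin n × {v : {v : InfinitePlace ↥(maximalRealSubfield L) // v.IsReal} // v ≠ cmPlace L ι₁})))) :=
  (reindexSp (cmBlockRelabel L dV hdV dW hdW ι₁ eP eQ)).comp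
    ((reindexSp (cmBlockSplit L e dV hdV dW hdW ι₁)).comp (cmArchPairPhaseHom L e dV hdV hdV0 dW hdW hdW0 ι₁))

/-- **`ω′`**: `cmArchWeilRep` in the scaled Folland frame, split at the place under `ι₁`, `V`-side relabelled. -/
abbrev cmBlockRep :
    Representation ℂ
      (UnitaryGroup.arch (↥(maximalRealSubfield L)) L (IsCMField.complexConj L) N (Matrix.diagonal dV) ×
        UnitaryGroup.arch (↥(maximalRealSubfield L)) L (IsCMField.complexConj L) M (Matrix.diagonal dW))
      (SchwartzMap
        (DPIdx (Fin 2) Unit (PosIdx (cmXW L dV dW hdW ι₁ (cmPlace L ι₁))) (NegIdx (cmXW L dV dW hdW ι₁ (cmPlace L ι₁))) ⊕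
          (Fin n × {v : {v : InfinitePlace ↥(maximalRealSubfield L) // v.IsReal} // v ≠ cmPlace L ι₁}) → ℝ) ℂ) :=
  repTransport (reindexCLE (cmBlockRelabel L dV hdV dW hdW ι₁ eP eQ))
    (repTransport (reindexCLE (cmBlockSplit L e dV hdV dW hdW ι₁))
      (repTransport (cmBigFrame L e dV hdV hdV0 dW hdW hdW0 ι₁) (cmArchWeilRep L e dV hdV hdV0 dW hdW hdW0 hGR)))

/-- **`hW` — the big archimedean datum of the CM pin in the block frame**, from the sign facts of the consumer's form (hypotheses of
`hasThetaMajorants_cmPairSplitting_of_signs` VERBATIM). [Folland1989, §4.2, Prop. (1.43); Weil1964, Chap. I n° 12, Chap. III n° 37–39] -/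
theorem isArchWeilDatum_cmBlock
    (h₁V : ∃ i₀ : Fin N, (∀ i, i ≠ i₀ → 0 < (ι₁ (dV i)).re) ∨ ∀ i, i ≠ i₀ → (ι₁ (dV i)).re < 0)
    (h₁W : (∀ j, 0 < (ι₁ (dW j)).re) ∨ ∀ j, (ι₁ (dW j)).re < 0)
    (hV : ∀ τ : L →+* ℂ, InfinitePlace.mk τ ≠ InfinitePlace.mk ι₁ →
      (∀ i, 0 < (τ (dV i)).re) ∨ ∀ i, (τ (dV i)).re < 0)
    (hW : ∀ τ : L →+* ℂ, InfinitePlace.mk τ ≠ InfinitePlace.mk ι₁ →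
      (∃ j₀ : Fin M, ∀ j, j ≠ j₀ → 0 < (τ (dW j)).re) ∨ ∀ j, (τ (dW j)).re < 0) :
    IsArchWeilDatum (cmBlockPhaseHom L e dV hdV hdV0 dW hdW hdW0 ι₁ eP eQ)
      (cmBlockRep L e dV hdV hdV0 dW hdW hdW0 hGR ι₁ eP eQ) :=
  ((isArchWeilDatum_repTransport_cmArchWeilRep_of_signs L e dV hdV hdV0 dW hdW hdW0 hGR ι₁ h₁V h₁W hV hW).reindex
      (cmBlockSplit L e dV hdV dW hdW ι₁)).reindex
    (cmBlockRelabel L dV hdV dW hdW ι₁ eP eQ)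

/-- **`hc`**: every operator of the block-frame representation is continuous. -/
theorem continuous_cmBlockRep
    (g : UnitaryGroup.arch (↥(maximalRealSubfield L)) L (IsCMField.complexConj L) N (Matrix.diagonal dV) ×
      UnitaryGroup.arch (↥(maximalRealSubfield L)) L (IsCMField.complexConj L) M (Matrix.diagonal dW)) :
    Continuous (cmBlockRep L e dV hdV hdV0 dW hdW hdW0 hGR ι₁ eP eQ g) :=
  continuous_repTransport_reindexCLE _
    (fun g => continuous_repTransport_reindexCLE _
      (fun g => continuous_repTransport_archWeilRep (↥(maximalRealSubfield L)) L (IsCMField.complexConj L) N M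
        (Matrix.diagonal dV) (Matrix.diagonal dW) (complexConj_imagUnit L) (imagUnit_ne_zero L) (imagUnit_mul_self L)
        (realDiagonal_isSymm L dV hdV) (realDiagonal_isSymm L dW hdW)
        (isUnit_det_realDiagonal L dV hdV hdV0) (isUnit_det_realDiagonal L dW hdW hdW0)
        (realDiagonal_map L dV hdV).symm (realDiagonal_map L dW hdW).symm e
        (cmSplittingOf L e dV hdV hdV0 dW hdW hdW0 hGR) (proj_cmSplittingOf L e dV hdV hdV0 dW hdW hdW0 hGR)
        (cmBigFrame L e dV hdV hdV0 dW hdW hdW0 ι₁) g) g) g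

/-! ## §3 The block section at the place under `ι₁`: `s`, `hs_cont`, `hs` -/

/-- **`s`**: the section `U(2,1)-frame × U(R,S) →* arch J_V × arch J_W` at the place under `ι₁` (T4's `archPairSection` at the canonical
frames, precomposed with T3's relabelling). -/
abbrev cmBlockSection :
    Ginf (Fin 2) Unit (PosIdx (cmXW L dV dW hdW ι₁ (cmPlace L ι₁))) (NegIdx (cmXW L dV dW hdW ι₁ (cmPlace L ι₁))) →*
      UnitaryGroup.arch (↥(maximalRealSubfield L)) L (IsCMField.complexConj L) N (Matrix.diagonal dV) ×
        UnitaryGroup.arch (↥(maximalRealSubfield L)) L (IsCMField.complexConj L) M (Matrix.diagonal dW) :=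
  (archPairSection L (IsCMField.complexConj L) N M (IsCMField.complexConj_ne_one L) (cmPlaceOver L) (cmPlaceOver_smul L)
      (cmPlaceOver_comap L) (cmRealVec L dV hdV) (cmRealVec L dW hdW) (realDiagonal_map L dV hdV).symm
      (realDiagonal_map L dW hdW).symm (cmEpsV L dV hdV ι₁) (cmEpsW L dV dW hdW ι₁) (cmDV_ne_zero L dV hdV hdV0 ι₁)
      (cmDW_ne_zero L dV dW hdW hdW0 ι₁) (cmSignConv_ne_zero L dV ι₁) (cmCW_ne_zero L dV ι₁) (cm_htV L dV hdV hdV0 ι₁)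
      (cm_htW L dV dW hdW hdW0 ι₁) (complexConj_smul_infinitePlace L) (cmPlace L ι₁)).comp
    (Ginf.relabel (PosIdx (cmXV L dV hdV ι₁ (cmPlace L ι₁))) (NegIdx (cmXV L dV hdV ι₁ (cmPlace L ι₁)))
        (PosIdx (cmXW L dV dW hdW ι₁ (cmPlace L ι₁))) (NegIdx (cmXW L dV dW hdW ι₁ (cmPlace L ι₁))) (Fin 2) Unit
        (PosIdx (cmXW L dV dW hdW ι₁ (cmPlace L ι₁))) (NegIdx (cmXW L dV dW hdW ι₁ (cmPlace L ι₁))) eP eQ (Equiv.refl _)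
        (Equiv.refl _)).symm.toMulEquiv.toMonoidHom

/-- **`hs_cont`**: the block section is continuous. -/
theorem continuous_cmBlockSection : Continuous (cmBlockSection L dV hdV hdV0 dW hdW hdW0 ι₁ eP eQ) :=
  (continuous_archPairSection L (IsCMField.complexConj L) N M (IsCMField.complexConj_ne_one L) (cmPlaceOver L)
      (cmPlaceOver_smul L) (cmPlaceOver_comap L) (cmRealVec L dV hdV) (cmRealVec L dW hdW) (realDiagonal_map L dV hdV).symm
      (realDiagonal_map L dW hdW).symm (cmEpsV L dV hdV ι₁) (cmEpsW L dV dW hdW ι₁) (cmDV_ne_zero L dV hdV hdV0 ι₁)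
      (cmDW_ne_zero L dV dW hdW hdW0 ι₁) (cmSignConv_ne_zero L dV ι₁) (cmCW_ne_zero L dV ι₁) (cm_htV L dV hdV hdV0 ι₁)
      (cm_htW L dV dW hdW hdW0 ι₁) (complexConj_smul_infinitePlace L) (cmPlace L ι₁)).comp
    (Ginf.relabel (PosIdx (cmXV L dV hdV ι₁ (cmPlace L ι₁))) (NegIdx (cmXV L dV hdV ι₁ (cmPlace L ι₁)))
        (PosIdx (cmXW L dV dW hdW ι₁ (cmPlace L ι₁))) (NegIdx (cmXW L dV dW hdW ι₁ (cmPlace L ι₁))) (Fin 2) Unit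
        (PosIdx (cmXW L dV dW hdW ι₁ (cmPlace L ι₁))) (NegIdx (cmXW L dV dW hdW ι₁ (cmPlace L ι₁))) eP eQ (Equiv.refl _)
        (Equiv.refl _)).symm.continuous

set_option maxHeartbeats 1600000 in
/-- **`hs` — the block section acts, in the block frame, by the block of Konno–Konno's `ι𝕎 (Fin 2) Unit R S` and the identity.**
[Weil1964, Chap. I n° 12; KonnoKonno2007, §3.1 (3.1); Folland1989, Prop. (1.43)] -/
theorem coe_cmBlockPhaseHom_cmBlockSection
    (u : Ginf (Fin 2) Unit (PosIdx (cmXW L dV dW hdW ι₁ (cmPlace L ι₁))) (NegIdx (cmXW L dV dW hdW ι₁ (cmPlace L ι₁)))) :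
    (⇑((cmBlockPhaseHom L e dV hdV hdV0 dW hdW hdW0 ι₁ eP eQ (cmBlockSection L dV hdV hdV0 dW hdW hdW0 ι₁ eP eQ u)).1 :
        ((DPIdx (Fin 2) Unit (PosIdx (cmXW L dV dW hdW ι₁ (cmPlace L ι₁))) (NegIdx (cmXW L dV dW hdW ι₁ (cmPlace L ι₁))) ⊕
            (Fin n × {v : {v : InfinitePlace ↥(maximalRealSubfield L) // v.IsReal} // v ≠ cmPlace L ι₁}) → ℝ) ×
          (DPIdx (Fin 2) Unit (PosIdx (cmXW L dV dW hdW ι₁ (cmPlace L ι₁))) (NegIdx (cmXW L dV dW hdW ι₁ (cmPlace L ι₁))) ⊕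
            (Fin n × {v : {v : InfinitePlace ↥(maximalRealSubfield L) // v.IsReal} // v ≠ cmPlace L ι₁}) → ℝ)) ≃ₗ[ℝ]
        ((DPIdx (Fin 2) Unit (PosIdx (cmXW L dV dW hdW ι₁ (cmPlace L ι₁))) (NegIdx (cmXW L dV dW hdW ι₁ (cmPlace L ι₁))) ⊕
            (Fin n × {v : {v : InfinitePlace ↥(maximalRealSubfield L) // v.IsReal} // v ≠ cmPlace L ι₁}) → ℝ) ×
          (DPIdx (Fin 2) Unit (PosIdx (cmXW L dV dW hdW ι₁ (cmPlace L ι₁))) (NegIdx (cmXW L dV dW hdW ι₁ (cmPlace L ι₁))) ⊕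
            (Fin n × {v : {v : InfinitePlace ↥(maximalRealSubfield L) // v.IsReal} // v ≠ cmPlace L ι₁}) → ℝ))) :
        PhaseMap (DPIdx (Fin 2) Unit (PosIdx (cmXW L dV dW hdW ι₁ (cmPlace L ι₁))) (NegIdx (cmXW L dV dW hdW ι₁ (cmPlace L ι₁))) ⊕
          (Fin n × {v : {v : InfinitePlace ↥(maximalRealSubfield L) // v.IsReal} // v ≠ cmPlace L ι₁}))) =
      blockPhase
        (⇑((ι𝕎 (Fin 2) Unit (PosIdx (cmXW L dV dW hdW ι₁ (cmPlace L ι₁))) (NegIdx (cmXW L dV dW hdW ι₁ (cmPlace L ι₁))) u).1 :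
          ((DPIdx (Fin 2) Unit (PosIdx (cmXW L dV dW hdW ι₁ (cmPlace L ι₁))) (NegIdx (cmXW L dV dW hdW ι₁ (cmPlace L ι₁))) → ℝ) ×
              (DPIdx (Fin 2) Unit (PosIdx (cmXW L dV dW hdW ι₁ (cmPlace L ι₁))) (NegIdx (cmXW L dV dW hdW ι₁ (cmPlace L ι₁))) → ℝ))
            ≃ₗ[ℝ]
            ((DPIdx (Fin 2) Unit (PosIdx (cmXW L dV dW hdW ι₁ (cmPlace L ι₁))) (NegIdx (cmXW L dV dW hdW ι₁ (cmPlace L ι₁))) → ℝ) ×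
              (DPIdx (Fin 2) Unit (PosIdx (cmXW L dV dW hdW ι₁ (cmPlace L ι₁))) (NegIdx (cmXW L dV dW hdW ι₁ (cmPlace L ι₁))) → ℝ))))
        id := by
  -- the canonical-frame pair element behind `u`
  have hu : Ginf.relabel (PosIdx (cmXV L dV hdV ι₁ (cmPlace L ι₁))) (NegIdx (cmXV L dV hdV ι₁ (cmPlace L ι₁)))
      (PosIdx (cmXW L dV dW hdW ι₁ (cmPlace L ι₁))) (NegIdx (cmXW L dV dW hdW ι₁ (cmPlace L ι₁))) (Fin 2) Unit
      (PosIdx (cmXW L dV dW hdW ι₁ (cmPlace L ι₁))) (NegIdx (cmXW L dV dW hdW ι₁ (cmPlace L ι₁))) eP eQ (Equiv.refl _)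
      (Equiv.refl _)
      ((Ginf.relabel (PosIdx (cmXV L dV hdV ι₁ (cmPlace L ι₁))) (NegIdx (cmXV L dV hdV ι₁ (cmPlace L ι₁)))
        (PosIdx (cmXW L dV dW hdW ι₁ (cmPlace L ι₁))) (NegIdx (cmXW L dV dW hdW ι₁ (cmPlace L ι₁))) (Fin 2) Unit
        (PosIdx (cmXW L dV dW hdW ι₁ (cmPlace L ι₁))) (NegIdx (cmXW L dV dW hdW ι₁ (cmPlace L ι₁))) eP eQ (Equiv.refl _)
        (Equiv.refl _)).symm.toMulEquiv.toMonoidHom u) = u :=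
    ContinuousMulEquiv.apply_symm_apply _ u
  -- step 1 (T2 + T4): in the split frame the section acts by the block of `ι𝕎 … u₀` and the identity
  have h₁ := coe_reindexSp_piPhaseHom_comp_section
    (fun v => pairFrame (PosIdx (cmXV L dV hdV ι₁ v)) (NegIdx (cmXV L dV hdV ι₁ v)) (PosIdx (cmXW L dV dW hdW ι₁ v))
      (NegIdx (cmXW L dV dW hdW ι₁ v)) e (cmEpsV L dV hdV ι₁ v) (cmEpsW L dV dW hdW ι₁ v))
    (fun v => ι𝕎 (PosIdx (cmXV L dV hdV ι₁ v)) (NegIdx (cmXV L dV hdV ι₁ v)) (PosIdx (cmXW L dV dW hdW ι₁ v))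
      (NegIdx (cmXW L dV dW hdW ι₁ v))) (cmPlace L ι₁)
    (MonoidHom.pi fun v =>
      (archPairPlace L (IsCMField.complexConj L) N M (IsCMField.complexConj_ne_one L) (cmPlaceOver L) (cmPlaceOver_smul L)
          (cmPlaceOver_comap L) (cmRealVec L dV hdV) (cmRealVec L dW hdW) (realDiagonal_map L dV hdV).symm
          (realDiagonal_map L dW hdW).symm (cmEpsV L dV hdV ι₁) (cmEpsW L dV dW hdW ι₁) (cmDV_ne_zero L dV hdV hdV0 ι₁)
          (cmDW_ne_zero L dV dW hdW hdW0 ι₁) (cmSignConv_ne_zero L dV ι₁) (cmCW_ne_zero L dV ι₁) (cm_htV L dV hdV hdV0 ι₁)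
          (cm_htW L dV dW hdW hdW0 ι₁) v).comp
        (archProdHom (↥(maximalRealSubfield L)) L (IsCMField.complexConj L) N M (Matrix.diagonal dV) (Matrix.diagonal dW)))
    (archPairSection L (IsCMField.complexConj L) N M (IsCMField.complexConj_ne_one L) (cmPlaceOver L) (cmPlaceOver_smul L)
      (cmPlaceOver_comap L) (cmRealVec L dV hdV) (cmRealVec L dW hdW) (realDiagonal_map L dV hdV).symm
      (realDiagonal_map L dW hdW).symm (cmEpsV L dV hdV ι₁) (cmEpsW L dV dW hdW ι₁) (cmDV_ne_zero L dV hdV hdV0 ι₁)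
      (cmDW_ne_zero L dV dW hdW hdW0 ι₁) (cmSignConv_ne_zero L dV ι₁) (cmCW_ne_zero L dV ι₁) (cm_htV L dV hdV hdV0 ι₁)
      (cm_htW L dV dW hdW hdW0 ι₁) (complexConj_smul_infinitePlace L) (cmPlace L ι₁))
    (fun g => archPairPlace_archPairSection L (IsCMField.complexConj L) N M (IsCMField.complexConj_ne_one L) (cmPlaceOver L)
      (cmPlaceOver_smul L) (cmPlaceOver_comap L) (cmRealVec L dV hdV) (cmRealVec L dW hdW) (realDiagonal_map L dV hdV).symm
      (realDiagonal_map L dW hdW).symm (cmEpsV L dV hdV ι₁) (cmEpsW L dV dW hdW ι₁) (cmDV_ne_zero L dV hdV hdV0 ι₁)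
      (cmDW_ne_zero L dV dW hdW hdW0 ι₁) (cmSignConv_ne_zero L dV ι₁) (cmCW_ne_zero L dV ι₁) (cm_htV L dV hdV hdV0 ι₁)
      (cm_htW L dV dW hdW hdW0 ι₁) (complexConj_smul_infinitePlace L) (cmPlace L ι₁) g)
    ((Ginf.relabel (PosIdx (cmXV L dV hdV ι₁ (cmPlace L ι₁))) (NegIdx (cmXV L dV hdV ι₁ (cmPlace L ι₁)))
        (PosIdx (cmXW L dV dW hdW ι₁ (cmPlace L ι₁))) (NegIdx (cmXW L dV dW hdW ι₁ (cmPlace L ι₁))) (Fin 2) Unit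
        (PosIdx (cmXW L dV dW hdW ι₁ (cmPlace L ι₁))) (NegIdx (cmXW L dV dW hdW ι₁ (cmPlace L ι₁))) eP eQ (Equiv.refl _)
        (Equiv.refl _)).symm.toMulEquiv.toMonoidHom u)
  -- the same with the phase homomorphism spelled as `cmArchPairPhaseHom` and the compositions applied
  simp only [MonoidHom.comp_apply] at h₁
  -- step 2 (T3): relabel the `V`-side block types to `Fin 2`, `Unit`
  have h₂ := coe_reindexSp_sumCongr_of_eq_blockPhase eP eQ
    (Equiv.refl (PosIdx (cmXW L dV dW hdW ι₁ (cmPlace L ι₁)))) (Equiv.refl (NegIdx (cmXW L dV dW hdW ι₁ (cmPlace L ι₁)))) _ _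
    h₁
  rw [hu] at h₂
  simpa only [MonoidHom.comp_apply, archPairPhaseHom] using h₂

end CMPinBlock

section CMPinBlockTwo

variable (L : Type) [Field L] [NumberField L] [IsCMField L]

/-- **`hW` at the pub-hodgecm pin `M = 2`** (hermitian plane `W`): the four binders `(h₁V h₁W hV)` + `ι₁` of unitary-1's `wmInputCM₂s`
suffice (`signs_fin_two`). -/
theorem isArchWeilDatum_cmBlock_two {N n : ℕ} (e : Fin N × Fin 2 ≃ Fin n)
    (dV : Fin N → L) (hdV : ∀ i, IsCMField.complexConj L (dV i) = dV i) (hdV0 : ∀ i, dV i ≠ 0)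
    (dW : Fin 2 → L) (hdW : ∀ i, IsCMField.complexConj L (dW i) = dW i) (hdW0 : ∀ i, dW i ≠ 0)
    (hGR : (cmSplittingDatum L e dV hdV hdV0 dW hdW hdW0).CompatibleSplitting) (ι₁ : L →+* ℂ)
    (eP : PosIdx (cmXV L dV hdV ι₁ (cmPlace L ι₁)) ≃ Fin 2) (eQ : NegIdx (cmXV L dV hdV ι₁ (cmPlace L ι₁)) ≃ Unit)
    (h₁V : ∃ i₀ : Fin N, (∀ i, i ≠ i₀ → 0 < (ι₁ (dV i)).re) ∨ ∀ i, i ≠ i₀ → (ι₁ (dV i)).re < 0)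
    (h₁W : (∀ j, 0 < (ι₁ (dW j)).re) ∨ ∀ j, (ι₁ (dW j)).re < 0)
    (hV : ∀ τ : L →+* ℂ, InfinitePlace.mk τ ≠ InfinitePlace.mk ι₁ →
      (∀ i, 0 < (τ (dV i)).re) ∨ ∀ i, (τ (dV i)).re < 0) :
    IsArchWeilDatum (cmBlockPhaseHom L e dV hdV hdV0 dW hdW hdW0 ι₁ eP eQ)
      (cmBlockRep L e dV hdV hdV0 dW hdW hdW0 hGR ι₁ eP eQ) :=
  isArchWeilDatum_cmBlock L e dV hdV hdV0 dW hdW hdW0 hGR ι₁ eP eQ h₁V h₁W hV fun τ _ =>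
    signs_fin_two fun j => re_apply_ne_zero_of_complexConj_eq L τ (hdW j) (hdW0 j)

end CMPinBlockTwo

end HodgeCM.Model.HypCensus

end
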